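import Literature.AnabelianGeometry.SemiGraphs.TemperedPiCharacteristicTowerOfCharCores
import Literature.AnabelianGeometry.SemiGraphs.TemperedSec6OfSpecialFibreTower
import HarnessLib

/-!
# [SemiAnbd] §6 (Lem. 6.1 (ii)(iii), Lem. 6.3 (ii)(iii), Thm. 6.4 with T64-L07, Thm. 6.6) from Example
# 3.10's special-fibre tower with FINITE, COHERENT, SINGULAR fibres — no model residual

Mochizuki, *Semi-graphs of anabelioids*, Publ. RIMS **42** (2006) [SemiAnbd]: Lemma 6.1 (ii)(iii) p. 69,
Lemma 6.3 (ii)(iii) p. 70, Theorem 6.4 pp. 70–71, Theorem 6.6 pp. 72–73; Example 3.10 pp. 43–45 ("`N_i`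
determines a finite log étale covering of `X^log_K`, whose geometric special fiber gives rise to semi-graphs
of anabelioids `𝒢_i`; `𝒢^c_i` … Recall from Example 2.10 that `𝒢_i`, `𝒢^c_i` are coherent …",
"`Δ` is the inverse limit of the `Δ[i]`"). [cite: MochizukiSemiAnbd2006, §6 pp.69-73; Ex 3.10 pp.43-45]

PROOF-ONLY sequel of `TemperedSec6OfSpecialFibreTower.lean` (abc-iut cell, D-0079 L-F sub-cell
[SemiAnbd]+[CombGC], pack D «§6 tempered anabelian», seat abc-iut-f-174 gen 4; rows F-1663 / F-1678 /
F-1706 (Lem. 6.1), F-1662 / F-2837 / F-1705 (Lem. 6.3), F-1693 / F-2838 (Thm. 6.4), F-1707 (Thm. 6.6); no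
definition, no instance, no new named fact).  There the leaf (L-B1′) — a CHARACTERISTIC André tower at
every level chart `π₁^temp(𝒢_i)` — was a displayed binder `hch` (GAP-LEDGER G-w5d240-1).  abc-iut-w5-d240's
`TemperedCurve.tower_of_specialFibreTower_of_finite'` (`TemperedPiCharacteristicTowerOfCharCores.lean`)
DISCHARGES it for level fibres that are FINITE, COHERENT and carry a CLOSED EDGE (singular special fibre):
the characteristic open cores of the topologically finitely generated `π₁^temp(𝒢_i)`.  This file re-knits
the nine rows over that theorem, so that each reads, in ONE theorem, as a consequence of:

* (L-η′) `d : X.GroupLevelData` (ruling η′: `Π^temp_{X_K}` tempered, Galois-countable, …);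
* (L-Ex310) `T : SpecialFibreTower X.DeltaTemp` with (P0) `hP0` (admissible kernels normal in
  `Π^temp_{X_K}`, [IUTchI] p. 50) and (h1) `hlim` ("`Δ = lim Δ[i]`" topologically, p. 45);
* (L-fin) `hfinV`, `hfinE`, `hcoh`: the fibres `𝒢^c_i` are FINITE and COHERENT (p. 44: dual semi-graphs
  of geometric special fibres of stable models; "coherent" by Example 2.10);
* (L-sing) `hcl : ∀ i, ∃ e, IsClosedEdge e` — every level's special fibre is SINGULAR (has a node).  For a
  genuine curve this means: index the printed tower from a level with singular stable reduction (levels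
  above a singular level stay singular); such a level exists for every proper hyperbolic curve over a
  finite extension of `ℚ_p` — Tamagawa, *Resolution of nonsingularities of families of curves*, Publ.
  RIMS **40** (2004), Thm. 0.2 (iv)(v) — recorded for the pack-D leaf census, not used here;
* the row's own printed input where print has one (Thm. 6.4: `GeometricIsDFG C`,
  `GeometricIsGaloisCompatible C`, `ProfiniteAnabelianTheorem C` = [Mzk8] Thm. 1.2, FACT-LIST F-2836;
  Thm. 6.6: the specialisation isomorphism systems `SpecializationIsoSystem`).

Pure composition of landed theorems; the leaves are hypotheses, displayed, never asserted; nothing here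
takes a side on [IUTchIII] Cor. 3.12; typed ≠ proved.
-/

noncomputable section

namespace Literature.AnabelianGeometry.SemiGraphs

open _root_.Topology

namespace TemperedCurve

variable {p : ℕ} [Fact p.Prime] (X : TemperedCurve p)

/-! ### Lemma 6.1 (ii), (iii) — rows F-1663, F-1678, F-1706 -/

/-- **[SemiAnbd] Lemma 6.1 (ii) AND (iii) at `X`** (rows F-1663, F-1678; the `X`-instance of F-1706) from
(L-η′) + (L-Ex310) + (L-fin) + (L-sing): `N_{Δ_X}(Δ^temp_X) = Δ^temp_X` and
`N_{Π_{X_K}}(Π^temp_{X_K}) = Π^temp_{X_K}`. [cite: MochizukiSemiAnbd2006, Lem 6.1(ii)-(iii) p.69] -/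
theorem profiniteNormalizers_of_specialFibreTower_of_finite (d : X.GroupLevelData)
    (T : SpecialFibreTower X.DeltaTemp)
    (hP0 : ∀ i, ((T.admKer i).map X.DeltaTemp.subtype).Normal)
    (hlim : ∀ U ∈ 𝓝 (1 : X.DeltaTemp), ∃ i, ∃ V ∈ 𝓝 (1 : (T.chart i).G),
      ∀ n : T.N i, T.adm i n ∈ V → (n : X.DeltaTemp) ∈ U)
    (hfinV : ∀ i, Finite (T.Gc i).graph.Vertex) (hfinE : ∀ i, Finite (T.Gc i).graph.Edge)
    (hcoh : ∀ i, (T.Gc i).IsCoherent)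
    (hcl : ∀ i, ∃ e : (T.Gc i).graph.Edge, (T.Gc i).graph.IsClosedEdge e) :
    X.DeltaTempNormallyTerminal ∧ X.PiTempNormallyTerminal :=
  X.profiniteNormalizers_of_tower d
    (X.tower_of_specialFibreTower_of_finite' d T hP0 hlim hfinV hfinE hcoh hcl)

/-- **[SemiAnbd] Lemma 6.1 (ii) at `X`** (row F-1663 `DeltaTempNormallyTerminal`) from (L-η′) + (L-Ex310)
+ (L-fin) + (L-sing). [cite: MochizukiSemiAnbd2006, Lem 6.1(ii) p.69] -/
theorem deltaTempNormallyTerminal_of_specialFibreTower_of_finite (d : X.GroupLevelData)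
    (T : SpecialFibreTower X.DeltaTemp)
    (hP0 : ∀ i, ((T.admKer i).map X.DeltaTemp.subtype).Normal)
    (hlim : ∀ U ∈ 𝓝 (1 : X.DeltaTemp), ∃ i, ∃ V ∈ 𝓝 (1 : (T.chart i).G),
      ∀ n : T.N i, T.adm i n ∈ V → (n : X.DeltaTemp) ∈ U)
    (hfinV : ∀ i, Finite (T.Gc i).graph.Vertex) (hfinE : ∀ i, Finite (T.Gc i).graph.Edge)
    (hcoh : ∀ i, (T.Gc i).IsCoherent)
    (hcl : ∀ i, ∃ e : (T.Gc i).graph.Edge, (T.Gc i).graph.IsClosedEdge e) :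
    X.DeltaTempNormallyTerminal :=
  (X.profiniteNormalizers_of_specialFibreTower_of_finite d T hP0 hlim hfinV hfinE hcoh hcl).1

/-- **[SemiAnbd] Lemma 6.1 (iii) at `X`** (row F-1678 `PiTempNormallyTerminal`) from (L-η′) + (L-Ex310)
+ (L-fin) + (L-sing). [cite: MochizukiSemiAnbd2006, Lem 6.1(iii) p.69] -/
theorem piTempNormallyTerminal_of_specialFibreTower_of_finite (d : X.GroupLevelData)
    (T : SpecialFibreTower X.DeltaTemp)
    (hP0 : ∀ i, ((T.admKer i).map X.DeltaTemp.subtype).Normal)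
    (hlim : ∀ U ∈ 𝓝 (1 : X.DeltaTemp), ∃ i, ∃ V ∈ 𝓝 (1 : (T.chart i).G),
      ∀ n : T.N i, T.adm i n ∈ V → (n : X.DeltaTemp) ∈ U)
    (hfinV : ∀ i, Finite (T.Gc i).graph.Vertex) (hfinE : ∀ i, Finite (T.Gc i).graph.Edge)
    (hcoh : ∀ i, (T.Gc i).IsCoherent)
    (hcl : ∀ i, ∃ e : (T.Gc i).graph.Edge, (T.Gc i).graph.IsClosedEdge e) :
    X.PiTempNormallyTerminal :=
  (X.profiniteNormalizers_of_specialFibreTower_of_finite d T hP0 hlim hfinV hfinE hcoh hcl).2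

/-! ### Lemma 6.3 (ii), (iii) — rows F-1662, F-2837, F-1705 -/

/-- **[SemiAnbd] Lemma 6.3 (ii) and (iii), both cases, at `X`** (the `X`-instance of F-1705) from (L-η′)
+ (L-Ex310) + (L-fin) + (L-sing). [cite: MochizukiSemiAnbd2006, Lem 6.3(ii)-(iii) p.70] -/
theorem denseSubgroups_of_specialFibreTower_of_finite (d : X.GroupLevelData)
    (T : SpecialFibreTower X.DeltaTemp)
    (hP0 : ∀ i, ((T.admKer i).map X.DeltaTemp.subtype).Normal)
    (hlim : ∀ U ∈ 𝓝 (1 : X.DeltaTemp), ∃ i, ∃ V ∈ 𝓝 (1 : (T.chart i).G),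
      ∀ n : T.N i, T.adm i n ∈ V → (n : X.DeltaTemp) ∈ U)
    (hfinV : ∀ i, Finite (T.Gc i).graph.Vertex) (hfinE : ∀ i, Finite (T.Gc i).graph.Edge)
    (hcoh : ∀ i, (T.Gc i).IsCoherent)
    (hcl : ∀ i, ∃ e : (T.Gc i).graph.Edge, (T.Gc i).graph.IsClosedEdge e) :
    X.PiTempDFGIffDOF ∧ X.DeltaTempDFGIffDOF ∧ X.PiTempDenseDOFConjugator ∧
      X.DeltaTempDenseDOFConjugator :=
  X.denseSubgroups_of_tower d (X.tower_of_specialFibreTower_of_finite' d T hP0 hlim hfinV hfinE hcoh hcl)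

/-- **[SemiAnbd] Lemma 6.3 (iii) for `F = Δ^temp_X` at `X`** (row F-1662 `DeltaTempDenseDOFConjugator`)
from (L-η′) + (L-Ex310) + (L-fin) + (L-sing). [cite: MochizukiSemiAnbd2006, Lem 6.3(iii) p.70] -/
theorem deltaTempDenseDOFConjugator_of_specialFibreTower_of_finite (d : X.GroupLevelData)
    (T : SpecialFibreTower X.DeltaTemp)
    (hP0 : ∀ i, ((T.admKer i).map X.DeltaTemp.subtype).Normal)
    (hlim : ∀ U ∈ 𝓝 (1 : X.DeltaTemp), ∃ i, ∃ V ∈ 𝓝 (1 : (T.chart i).G),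
      ∀ n : T.N i, T.adm i n ∈ V → (n : X.DeltaTemp) ∈ U)
    (hfinV : ∀ i, Finite (T.Gc i).graph.Vertex) (hfinE : ∀ i, Finite (T.Gc i).graph.Edge)
    (hcoh : ∀ i, (T.Gc i).IsCoherent)
    (hcl : ∀ i, ∃ e : (T.Gc i).graph.Edge, (T.Gc i).graph.IsClosedEdge e) :
    X.DeltaTempDenseDOFConjugator :=
  (X.denseSubgroups_of_specialFibreTower_of_finite d T hP0 hlim hfinV hfinE hcoh hcl).2.2.2

/-- **[SemiAnbd] Lemma 6.3 (iii) at the finite étale coverings** (row F-2837 `OpenDenseDOFConjugator`,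
the Thm. 6.4 sub-node T64-L06′) at `X` from (L-η′) + (L-Ex310) + (L-fin) + (L-sing).
[cite: MochizukiSemiAnbd2006, Lem 6.3(iii) p.70] -/
theorem openDenseDOFConjugator_of_specialFibreTower_of_finite (d : X.GroupLevelData)
    (T : SpecialFibreTower X.DeltaTemp)
    (hP0 : ∀ i, ((T.admKer i).map X.DeltaTemp.subtype).Normal)
    (hlim : ∀ U ∈ 𝓝 (1 : X.DeltaTemp), ∃ i, ∃ V ∈ 𝓝 (1 : (T.chart i).G),
      ∀ n : T.N i, T.adm i n ∈ V → (n : X.DeltaTemp) ∈ U)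
    (hfinV : ∀ i, Finite (T.Gc i).graph.Vertex) (hfinE : ∀ i, Finite (T.Gc i).graph.Edge)
    (hcoh : ∀ i, (T.Gc i).IsCoherent)
    (hcl : ∀ i, ∃ e : (T.Gc i).graph.Edge, (T.Gc i).graph.IsClosedEdge e) :
    X.OpenDenseDOFConjugator :=
  X.openDenseDOFConjugator_of_tower d.isTempered
    (X.tower_of_specialFibreTower_of_finite' d T hP0 hlim hfinV hfinE hcoh hcl)

/-! ### Theorem 6.4 — rows F-1693, F-2838 -/

/-- **[SemiAnbd] Theorem 6.4 for a dominant `C : X → Y`** (the `X`/`Y`-instance of F-1693) from its printed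
inputs `h01` (F-2831), `h01b` (F-2832), `h04` ([Mzk8] Thm. 1.2, F-2836) and, for `Π^temp_{Y_L}`, (L-η′) +
(L-Ex310) + (L-fin) + (L-sing). [cite: MochizukiSemiAnbd2006, Thm 6.4 pp.70-71] -/
theorem temperedAnabelianTheorem_of_specialFibreTower_of_finite {X Y : TemperedCurve p}
    (C : TemperedCurveHom p X Y)
    (h01 : GeometricIsDFG C) (h01b : GeometricIsGaloisCompatible C) (h04 : ProfiniteAnabelianTheorem C)
    (d : Y.GroupLevelData) (T : SpecialFibreTower Y.DeltaTemp)
    (hP0 : ∀ i, ((T.admKer i).map Y.DeltaTemp.subtype).Normal)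
    (hlim : ∀ U ∈ 𝓝 (1 : Y.DeltaTemp), ∃ i, ∃ V ∈ 𝓝 (1 : (T.chart i).G),
      ∀ n : T.N i, T.adm i n ∈ V → (n : Y.DeltaTemp) ∈ U)
    (hfinV : ∀ i, Finite (T.Gc i).graph.Vertex) (hfinE : ∀ i, Finite (T.Gc i).graph.Edge)
    (hcoh : ∀ i, (T.Gc i).IsCoherent)
    (hcl : ∀ i, ∃ e : (T.Gc i).graph.Edge, (T.Gc i).graph.IsClosedEdge e) :
    TemperedAnabelianTheorem C :=
  temperedAnabelianTheorem_of_tower C h01 h01b h04 d.isTempered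
    (Y.tower_of_specialFibreTower_of_finite' d T hP0 hlim hfinV hfinE hcoh hcl)

/-- **[SemiAnbd] Thm. 6.4, T64-L07 `OuterDescent X Y`** (row F-2838) from (L-η′) + (L-Ex310) + (L-fin) +
(L-sing) for `Y`. [cite: MochizukiSemiAnbd2006, Thm 6.4 proof p.71] -/
theorem outerDescent_of_specialFibreTower_of_finite (X Y : TemperedCurve p) (d : Y.GroupLevelData)
    (T : SpecialFibreTower Y.DeltaTemp)
    (hP0 : ∀ i, ((T.admKer i).map Y.DeltaTemp.subtype).Normal)
    (hlim : ∀ U ∈ 𝓝 (1 : Y.DeltaTemp), ∃ i, ∃ V ∈ 𝓝 (1 : (T.chart i).G),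
      ∀ n : T.N i, T.adm i n ∈ V → (n : Y.DeltaTemp) ∈ U)
    (hfinV : ∀ i, Finite (T.Gc i).graph.Vertex) (hfinE : ∀ i, Finite (T.Gc i).graph.Edge)
    (hcoh : ∀ i, (T.Gc i).IsCoherent)
    (hcl : ∀ i, ∃ e : (T.Gc i).graph.Edge, (T.Gc i).graph.IsClosedEdge e) :
    OuterDescent X Y :=
  outerDescent_of_openDenseDOFConjugator X Y
    (Y.openDenseDOFConjugator_of_specialFibreTower_of_finite d T hP0 hlim hfinV hfinE hcoh hcl)

/-! ### Theorem 6.6 — row F-1707 -/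

/-- **[SemiAnbd] Theorem 6.6 for `X`, `Y`** (the `X`/`Y`-instance of F-1707) from the specialisation
isomorphism systems of its printed proof (`hS`) and, for `Π^temp_{Y_L}`, (L-η′) + (L-Ex310) + (L-fin) +
(L-sing). [cite: MochizukiSemiAnbd2006, Thm 6.6 pp.72-73] -/
theorem profiniteOuterIsoLifts_of_system_of_specialFibreTower_of_finite {X Y : TemperedCurve p}
    (hS : ∀ αhat : X.PiHat ≃ₜ* Y.PiHat, Nonempty (SpecializationIsoSystem X Y αhat))
    (d : Y.GroupLevelData) (T : SpecialFibreTower Y.DeltaTemp)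
    (hP0 : ∀ i, ((T.admKer i).map Y.DeltaTemp.subtype).Normal)
    (hlim : ∀ U ∈ 𝓝 (1 : Y.DeltaTemp), ∃ i, ∃ V ∈ 𝓝 (1 : (T.chart i).G),
      ∀ n : T.N i, T.adm i n ∈ V → (n : Y.DeltaTemp) ∈ U)
    (hfinV : ∀ i, Finite (T.Gc i).graph.Vertex) (hfinE : ∀ i, Finite (T.Gc i).graph.Edge)
    (hcoh : ∀ i, (T.Gc i).IsCoherent)
    (hcl : ∀ i, ∃ e : (T.Gc i).graph.Edge, (T.Gc i).graph.IsClosedEdge e) :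
    X.ProfiniteOuterIsoLifts Y :=
  profiniteOuterIsoLifts_of_system hS
    (Y.piTempNormallyTerminal_of_specialFibreTower_of_finite d T hP0 hlim hfinV hfinE hcoh hcl)

/-! ### From finite singular Example 3.10 data to the `htower₀` packages of the origin-level closers -/

/-- Finite, coherent, singular Example 3.10 data supply `Nonempty X.GroupLevelData ∧ htower₀`.
[cite: MochizukiSemiAnbd2006, Ex 3.10 pp.44-45] -/
theorem groupLevelData_and_tower_of_specialFibreTower_of_finite
    (h : Nonempty X.GroupLevelData ∧ ∃ T : SpecialFibreTower X.DeltaTemp,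
      (∀ i, ((T.admKer i).map X.DeltaTemp.subtype).Normal) ∧
      (∀ U ∈ 𝓝 (1 : X.DeltaTemp), ∃ i, ∃ V ∈ 𝓝 (1 : (T.chart i).G),
        ∀ n : T.N i, T.adm i n ∈ V → (n : X.DeltaTemp) ∈ U) ∧
      (∀ i, Finite (T.Gc i).graph.Vertex) ∧ (∀ i, Finite (T.Gc i).graph.Edge) ∧
      (∀ i, (T.Gc i).IsCoherent) ∧
      (∀ i, ∃ e : (T.Gc i).graph.Edge, (T.Gc i).graph.IsClosedEdge e)) :
    Nonempty X.GroupLevelData ∧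
      ∀ U ∈ 𝓝 (1 : X.PiTemp), ∃ N : OpenNormalSubgroup X.PiTemp, (N : Set X.PiTemp) ⊆ U ∧
        ∃ (G : Subgroup (X.PiTemp ⧸ N.toSubgroup)) (_ : IsFreeGroup G), G.Normal ∧ G.FiniteIndex ∧
          Finite (IsFreeGroup.Generators G) ∧ ∃ a ∈ G, ∃ b ∈ G, a * b ≠ b * a := by
  obtain ⟨⟨d⟩, T, hP0, hlim, hfinV, hfinE, hcoh, hcl⟩ := h
  exact ⟨⟨d⟩, X.tower_of_specialFibreTower_of_finite' d T hP0 hlim hfinV hfinE hcoh hcl⟩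

/-- The same package in the shape `IsTempered X.PiTemp ∧ htower₀`.
[cite: MochizukiSemiAnbd2006, Ex 3.10 pp.44-45] -/
theorem isTempered_and_tower_of_specialFibreTower_of_finite
    (h : Nonempty X.GroupLevelData ∧ ∃ T : SpecialFibreTower X.DeltaTemp,
      (∀ i, ((T.admKer i).map X.DeltaTemp.subtype).Normal) ∧
      (∀ U ∈ 𝓝 (1 : X.DeltaTemp), ∃ i, ∃ V ∈ 𝓝 (1 : (T.chart i).G),
        ∀ n : T.N i, T.adm i n ∈ V → (n : X.DeltaTemp) ∈ U) ∧
      (∀ i, Finite (T.Gc i).graph.Vertex) ∧ (∀ i, Finite (T.Gc i).graph.Edge) ∧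
      (∀ i, (T.Gc i).IsCoherent) ∧
      (∀ i, ∃ e : (T.Gc i).graph.Edge, (T.Gc i).graph.IsClosedEdge e)) :
    IsTempered X.PiTemp ∧
      ∀ U ∈ 𝓝 (1 : X.PiTemp), ∃ N : OpenNormalSubgroup X.PiTemp, (N : Set X.PiTemp) ⊆ U ∧
        ∃ (G : Subgroup (X.PiTemp ⧸ N.toSubgroup)) (_ : IsFreeGroup G), G.Normal ∧ G.FiniteIndex ∧
          Finite (IsFreeGroup.Generators G) ∧ ∃ a ∈ G, ∃ b ∈ G, a * b ≠ b * a := by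
  obtain ⟨⟨d⟩, T, hP0, hlim, hfinV, hfinE, hcoh, hcl⟩ := h
  exact ⟨d.isTempered, X.tower_of_specialFibreTower_of_finite' d T hP0 hlim hfinV hfinE hcoh hcl⟩

end TemperedCurve

/-! ### The origin-quantified printed statements -/

namespace TemperedOrigin

variable {p : ℕ} [Fact p.Prime]

/-- **[SemiAnbd] Lemma 6.1 (ii), (iii) as printed** (row F-1706 `ProfiniteNormalizersHolds`): holds as soon
as every certified curve carries (L-η′) group-level parameters and (L-Ex310) an Example 3.10 special-fibre
tower with (P0), (h1) whose fibres are (L-fin) finite, coherent and (L-sing) singular.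
[cite: MochizukiSemiAnbd2006, Lem 6.1(ii)-(iii) p.69] -/
theorem profiniteNormalizersHolds_of_specialFibreTower_of_finite (Ω : TemperedOrigin p)
    (hEx : ∀ X : TemperedCurve p, Ω.IsHyperbolicCurveOrigin X →
      Nonempty X.GroupLevelData ∧ ∃ T : SpecialFibreTower X.DeltaTemp,
        (∀ i, ((T.admKer i).map X.DeltaTemp.subtype).Normal) ∧
        (∀ U ∈ 𝓝 (1 : X.DeltaTemp), ∃ i, ∃ V ∈ 𝓝 (1 : (T.chart i).G),
          ∀ n : T.N i, T.adm i n ∈ V → (n : X.DeltaTemp) ∈ U) ∧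
        (∀ i, Finite (T.Gc i).graph.Vertex) ∧ (∀ i, Finite (T.Gc i).graph.Edge) ∧
        (∀ i, (T.Gc i).IsCoherent) ∧
        (∀ i, ∃ e : (T.Gc i).graph.Edge, (T.Gc i).graph.IsClosedEdge e)) :
    Ω.ProfiniteNormalizersHolds :=
  Ω.profiniteNormalizersHolds_of_tower fun X hX =>
    X.groupLevelData_and_tower_of_specialFibreTower_of_finite (hEx X hX)

/-- **[SemiAnbd] Lemma 6.3 (ii), (iii) as printed** (row F-1705 `DenseSubgroupsHolds`) from the same
origin-level leaves (L-η′), (L-Ex310), (L-fin), (L-sing). [cite: MochizukiSemiAnbd2006, Lem 6.3(ii)-(iii) p.70] -/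
theorem denseSubgroupsHolds_of_specialFibreTower_of_finite (Ω : TemperedOrigin p)
    (hEx : ∀ X : TemperedCurve p, Ω.IsHyperbolicCurveOrigin X →
      Nonempty X.GroupLevelData ∧ ∃ T : SpecialFibreTower X.DeltaTemp,
        (∀ i, ((T.admKer i).map X.DeltaTemp.subtype).Normal) ∧
        (∀ U ∈ 𝓝 (1 : X.DeltaTemp), ∃ i, ∃ V ∈ 𝓝 (1 : (T.chart i).G),
          ∀ n : T.N i, T.adm i n ∈ V → (n : X.DeltaTemp) ∈ U) ∧
        (∀ i, Finite (T.Gc i).graph.Vertex) ∧ (∀ i, Finite (T.Gc i).graph.Edge) ∧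
        (∀ i, (T.Gc i).IsCoherent) ∧
        (∀ i, ∃ e : (T.Gc i).graph.Edge, (T.Gc i).graph.IsClosedEdge e)) :
    Ω.DenseSubgroupsHolds :=
  Ω.denseSubgroupsHolds_of_tower fun X hX =>
    X.groupLevelData_and_tower_of_specialFibreTower_of_finite (hEx X hX)

/-- **[SemiAnbd] Theorem 6.6 as printed** (row F-1707 `ProfiniteOuterIsoLiftsHolds`) from the origin-guarded
specialisation-system input of its printed proof and the origin-level leaves (L-η′), (L-Ex310), (L-fin),
(L-sing). [cite: MochizukiSemiAnbd2006, Thm 6.6 pp.72-73] -/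
theorem profiniteOuterIsoLiftsHolds_of_specialFibreTower_of_finite (Ω : TemperedOrigin p)
    (hS : Ω.SpecializationIsoSystemHolds)
    (hEx : ∀ X : TemperedCurve p, Ω.IsHyperbolicCurveOrigin X →
      Nonempty X.GroupLevelData ∧ ∃ T : SpecialFibreTower X.DeltaTemp,
        (∀ i, ((T.admKer i).map X.DeltaTemp.subtype).Normal) ∧
        (∀ U ∈ 𝓝 (1 : X.DeltaTemp), ∃ i, ∃ V ∈ 𝓝 (1 : (T.chart i).G),
          ∀ n : T.N i, T.adm i n ∈ V → (n : X.DeltaTemp) ∈ U) ∧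
        (∀ i, Finite (T.Gc i).graph.Vertex) ∧ (∀ i, Finite (T.Gc i).graph.Edge) ∧
        (∀ i, (T.Gc i).IsCoherent) ∧
        (∀ i, ∃ e : (T.Gc i).graph.Edge, (T.Gc i).graph.IsClosedEdge e)) :
    Ω.ProfiniteOuterIsoLiftsHolds :=
  Ω.profiniteOuterIsoLiftsHolds_of_tower hS fun Y hY =>
    Y.isTempered_and_tower_of_specialFibreTower_of_finite (hEx Y hY)

end TemperedOrigin

namespace TemperedMorphismOrigin

variable {p : ℕ} [Fact p.Prime]

/-- **[SemiAnbd] Theorem 6.4 as printed** (row F-1693 `TemperedAnabelianTheoremHolds`) from the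
`π₁^temp`-functor clauses + [Mzk8] Thm. 1.2 for certified dominant morphisms (`hfun`: instance forms of
F-2831, F-2832, F-2836) and the origin-level leaves (L-η′), (L-Ex310), (L-fin), (L-sing).
[cite: MochizukiSemiAnbd2006, Thm 6.4 pp.70-71] -/
theorem temperedAnabelianTheoremHolds_of_specialFibreTower_of_finite (Ω : TemperedMorphismOrigin p)
    (hfun : ∀ (X Y : TemperedCurve p) (C : TemperedCurveHom p X Y), Ω.IsHyperbolicCurveOrigin X →
      Ω.IsHyperbolicCurveOrigin Y → Ω.IsDomHomOrigin C →
        TemperedCurve.GeometricIsDFG C ∧ TemperedCurve.GeometricIsGaloisCompatible C ∧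
          TemperedCurve.ProfiniteAnabelianTheorem C)
    (hEx : ∀ X : TemperedCurve p, Ω.IsHyperbolicCurveOrigin X →
      Nonempty X.GroupLevelData ∧ ∃ T : SpecialFibreTower X.DeltaTemp,
        (∀ i, ((T.admKer i).map X.DeltaTemp.subtype).Normal) ∧
        (∀ U ∈ 𝓝 (1 : X.DeltaTemp), ∃ i, ∃ V ∈ 𝓝 (1 : (T.chart i).G),
          ∀ n : T.N i, T.adm i n ∈ V → (n : X.DeltaTemp) ∈ U) ∧
        (∀ i, Finite (T.Gc i).graph.Vertex) ∧ (∀ i, Finite (T.Gc i).graph.Edge) ∧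
        (∀ i, (T.Gc i).IsCoherent) ∧
        (∀ i, ∃ e : (T.Gc i).graph.Edge, (T.Gc i).graph.IsClosedEdge e)) :
    Ω.TemperedAnabelianTheoremHolds :=
  Ω.temperedAnabelianTheoremHolds_of_tower hfun fun Y hY =>
    Y.isTempered_and_tower_of_specialFibreTower_of_finite (hEx Y hY)

end TemperedMorphismOrigin

end Literature.AnabelianGeometry.SemiGraphs

end
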